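import Summits.BirchSwinnertonDyer.Rank1Residual.AdditivePotMult.EigenLeadingTermThree
import Summits.BirchSwinnertonDyer.Rank1Residual.AdditivePotMult.RankZeroChiBranchImage
import HarnessLib

/-!
# X3♯(M) and X4(M) ∧ surj(3) at `p = 3`, analytic rank `0`: the UPPER HALF of `BSD(E,3)` CLASS-WIDE
# from published theorems + kernel glue, and `BSD(E,3)` on the `3 ∤ #Ш_an(E)` rows
# (cell `b2b-bsdres`, seat additive-p1, gen 9 — the gen-6/7 `p = 3` consumers with their typed input DISCHARGED)

HONEST FRAMING (cell `b2b-bsdres`, run/shared/lean/b2b/bsd-rank1-residual/, verbatim in every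
file): the goal of the cell is to DELETE the COMBINATION-SHAPED residual classes of the
Birch–Swinnerton-Dyer formula for ALL analytic-rank `≤ 1` elliptic curves over `ℚ` — "full BSD
formula for every rank `≤ 1` curve in class `C`" assembled STRICTLY from published theorems — so
that the rank-`≤ 1` remainder becomes exactly the CONSTRUCTION-SHAPED classes, which are TYPED
(missing-input `Prop`s), NOT attempted. This is not "finishing BSD". The additive sub-cell (seats
additive-p1…p4) is a RESEARCH ROUTE on the construction-shaped classes X3/X4; sub-cell additive-p1
= the potentially MULTIPLICATIVE additive prime (X3♯(M) / X4(M)); no claim beyond the stated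
classes; the labels of X3/X4 are UNCHANGED by this file; nothing is booked.

Theorems only (pure compositions; no definition, no named fact minted). The gen-6/7 class theorems
`ClassX3M.missingUpperBoundAt_three_rankZero_of_chiBranchOdd` (p225681, `TamagawaAtP.lean`),
`ClassX4M.missingUpperBoundAt_three_rankZero_of_chiBranch_of_surj` (p225975/p226234,
`RankZeroChiBranchThree.lean`) and `ClassX4M.…_of_not_dvd_padicValRat_j_of_odd` (p226644,
`RankZeroChiBranchImage.lean`) took additive-p4's TYPED `χ₃`-branch input
`ChiBranchLeadingTermOdd[BigImage]At W 3` ([B∘C] at `T = 0`) as a hypothesis. Gen 8 put [C] in the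
kernel; gen 9 filed [B] at `p = 3` as the two componentwise reading-facts
`Wuthrich2014.thm16_minusEigenCharIdeal_dvd_cyclotomicThree` (p233088) /
`Wuthrich2014.kato_minusEigenCharIdeal_dvd_cyclotomicThree_of_surjective` (p233255) and proved
`chiBranchLeadingTermOddAt_three` / `chiBranchLeadingTermOddBigImageAt_three`
(`EigenLeadingTermThree.lean`): the typed input holds for EVERY `W`. THIS FILE substitutes it:

* §1 **X3♯(M) ∧ `r_an(E) = 0`, `p = 3`: `Typed.MissingUpperBoundAt W 3` = `ord₃ #Ш(E) ≤ ord₃ #Ш_an(E)`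
  for EVERY such curve** (`ClassX3M.missingUpperBoundAt_three_rankZero`) — inputs: Delbourgo 1998
  Prop. 4 (`hDel`), Gross–Zagier–Kolyvagin (`hGZK`), modularity (`hmod`, `hmodD`), Wuthrich 2014
  Thm. 16 read on the `ω`-component (`hW16`); NO Tamagawa, NO Manin, NO image, NO twist-side
  hypothesis (the twist `E^{(−3)}` may have any rank and any `Ш`); `BSD(E,3)` on the
  `3 ∤ #Ш_an(E)` rows (`…_of_shaAn_unit`) or given the LOWER half (`…_of_lower`); what remains of
  X3♯(M) there is EXACTLY the lower half (`ClassX3M.missingInputAt_iff_lower_three_rankZero`);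
* §2 **X4(M) ∧ `r_an(E) = 0` ∧ surj(3), `p = 3`: the same** (`ClassX4M.missingUpperBoundAt_three_rankZero_of_surj`)
  — inputs `hDel`, `hGZK`, `hmod`, `hmodD`, Wuthrich 2014 Lemma 20 (`hL20`, `3`-adic surjectivity of
  the multiplicative twist) and Kato's divisibility read on the `ω`-component (`hKato`); with
  `surj(3)` itself decided by `3 ∤ ord₃ j(E)` (`…_of_not_dvd_padicValRat_j`); `BSD(E,3)` on the
  `3 ∤ #Ш_an` rows / given the lower half; X4♯ there is EXACTLY the lower half.

Census pointers (hyp SC §50, N < 2·10⁴ ‖ 10⁴): X3♯(M) at `p = 3`: 266 ‖ 151 rank-`0` window rows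
(all but 3 with `3 ∤ #Ш_an`); X4(M) at `p = 3`: 771 rank-`0` rows, 821/861 (M)-rows with surj(3)
(additive-p4 V9e). These theorems need NO per-pair datum beyond the class bits, `r_an = 0` and
(for `BSD(E,3)`) `3 ∤ #Ш_an(E)` or a lower-half certificate. What they do NOT give: the LOWER half
(SU direction on the `ω`-branch — printed nowhere), ranks `≠ 0`. Labels UNCHANGED; X3♯(M)/X4(M)
stay CONSTRUCTION-SHAPED; nothing booked (referee).

References: Delbourgo 1998 [Delbourgo1998] Prop. 4; Wuthrich 2014 [Wuthrich2014] Thm. 16,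
Lemma 20, Cor. 19; Kato 2004 [Kato2004Asterisque] Thm. 17.4; Mazur–Tate–Teitelbaum 1986
[MazurTateTeitelbaum1986Invent] §I.13–I.14.
-/

noncomputable section

open scoped Classical

open WeierstrassCurve Literature.NumberTheory.EllipticCurves
  Literature.NumberTheory.EllipticCurves.ModularForms
  Literature.NumberTheory.EllipticCurves.Rank1Residual
  Literature.NumberTheory.EllipticCurves.Rank1Residual.Typed

namespace Summit.BirchSwinnertonDyer.Rank1Residual.AdditivePotMult

open Additive

variable {W : WeierstrassCurve ℚ} [W.IsElliptic] [W.IsGloballyMinimal]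

/-! ### §1 X3♯(M), `p = 3`, rank `0` -/

/-- **X3♯(M) ∧ `r_an(E) = 0` at `p = 3`: the upper half `ord₃ #Ш(E) ≤ ord₃ #Ш_an(E)` for EVERY such
curve, from published theorems + kernel glue** — Delbourgo 1998 Prop. 4 (`hDel`), GZK (`hGZK`),
modularity (`hmod`, `hmodD`) and Wuthrich 2014 Thm. 16 read on the `ω`-component over `ℚ(ζ_{3^∞})`
(`hW16`, p233088), through `chiBranchLeadingTermOddAt_three` (kernel transport [C] + odd branch at
`T = 0`) and the gen-7 consumer `ClassX3M.missingUpperBoundAt_three_rankZero_of_chiBranchOdd`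
(`c₃(E) ∈ {1,2,4}`). No Tamagawa / Manin / image / twist-side hypothesis. X3♯(M) stays
CONSTRUCTION-SHAPED (the lower half is printed nowhere); nothing booked.
[cite: Delbourgo1998, Prop. 4 (p. 144) and Lemma (ii) (p. 139)] [cite: Wuthrich2014, Thm. 16 (p. 397) and §3 (p. 390)] -/
theorem ClassX3M.missingUpperBoundAt_three_rankZero
    (hDel : Delbourgo1998.prop4_rankZero_pow_dvd_constantCoeff)
    (hGZK : rank_eq_analyticRank_of_analyticRank_le_one) (hmod : hasEntireLFunction_rat)
    (hmodD : nonempty_modularParametrizationData)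
    (hW16 : Wuthrich2014.thm16_minusEigenCharIdeal_dvd_cyclotomicThree)
    (hX : ClassX3M W 3) (hr : W.analyticRank = 0) : MissingUpperBoundAt W 3 :=
  ClassX3M.missingUpperBoundAt_three_rankZero_of_chiBranchOdd hDel hGZK hmod hmodD
    (chiBranchLeadingTermOddAt_three hW16 W) hX hr

/-- **X3♯(M) ∧ `r_an(E) = 0` ∧ `3 ∤ #Ш_an(E)`: `BSD(E,3)`** from published theorems + kernel glue.
[cite: Delbourgo1998, Prop. 4 (p. 144)] [cite: Wuthrich2014, Thm. 16 (p. 397)] -/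
theorem ClassX3M.bsdp_three_rankZero_of_shaAn_unit
    (hDel : Delbourgo1998.prop4_rankZero_pow_dvd_constantCoeff)
    (hGZK : rank_eq_analyticRank_of_analyticRank_le_one) (hmod : hasEntireLFunction_rat)
    (hmodD : nonempty_modularParametrizationData)
    (hW16 : Wuthrich2014.thm16_minusEigenCharIdeal_dvd_cyclotomicThree)
    (hX : ClassX3M W 3) (hr : W.analyticRank = 0)
    {q : ℚ} (hq : shaAn W = (q : ℂ)) (hv : padicValRat 3 q = 0) : BSDp W 3 :=
  ClassX3M.bsdp_three_rankZero_of_chiBranchOdd_of_shaAn_unit hDel hGZK hmod hmodD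
    (chiBranchLeadingTermOddAt_three hW16 W) hX hr hq hv

/-- **X3♯(M) ∧ `r_an(E) = 0`: `BSD(E,3)` from the LOWER half `ord₃ #Ш_an(E) ≤ ord₃ #Ш(E)`** (the
`3 ∣ #Ш_an` rows, e.g. the window pair 15138i1 with `#Ш_an = 9`: a `3`-descent certificate
`Ш(E)[3] ≠ 0` of the right size is exactly that half). [cite: Delbourgo1998, Prop. 4 (p. 144)]
[cite: Wuthrich2014, Thm. 16 (p. 397)] -/
theorem ClassX3M.bsdp_three_rankZero_of_lower
    (hDel : Delbourgo1998.prop4_rankZero_pow_dvd_constantCoeff)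
    (hGZK : rank_eq_analyticRank_of_analyticRank_le_one) (hmod : hasEntireLFunction_rat)
    (hmodD : nonempty_modularParametrizationData)
    (hW16 : Wuthrich2014.thm16_minusEigenCharIdeal_dvd_cyclotomicThree)
    (hX : ClassX3M W 3) (hr : W.analyticRank = 0) (hlow : MissingLowerBoundAt W 3) : BSDp W 3 :=
  bsdp_of_missingPPartAt W 3 hGZK (by rw [hr]; exact zero_le_one)
    (missingPPartAt_of_lower_of_upper W 3 hlow
      (ClassX3M.missingUpperBoundAt_three_rankZero hDel hGZK hmod hmodD hW16 hX hr))

/-- **X3♯(M) ∧ `r_an(E) = 0` at `p = 3`: what remains of X3♯ on these pairs is EXACTLY the lower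
half** — `Typed.X3.MissingInputAt W 3 ⟺ MissingLowerBoundAt W 3`.
[cite: Delbourgo1998, Prop. 4 (p. 144)] [cite: Wuthrich2014, Thm. 16 (p. 397)] -/
theorem ClassX3M.missingInputAt_iff_lower_three_rankZero
    (hDel : Delbourgo1998.prop4_rankZero_pow_dvd_constantCoeff)
    (hGZK : rank_eq_analyticRank_of_analyticRank_le_one) (hmod : hasEntireLFunction_rat)
    (hmodD : nonempty_modularParametrizationData)
    (hW16 : Wuthrich2014.thm16_minusEigenCharIdeal_dvd_cyclotomicThree)
    (hX : ClassX3M W 3) (hr : W.analyticRank = 0) :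
    X3.MissingInputAt W 3 ↔ MissingLowerBoundAt W 3 :=
  ⟨fun h ↦ (lower_and_upper_of_missingPPartAt W 3 h).1, fun h ↦
    missingPPartAt_of_lower_of_upper W 3 h
      (ClassX3M.missingUpperBoundAt_three_rankZero hDel hGZK hmod hmodD hW16 hX hr)⟩

/-! ### §2 X4(M) ∧ surj(3), `p = 3`, rank `0` -/

/-- **X4(M) ∧ `r_an(E) = 0` ∧ surj(3) at `p = 3`: the upper half `ord₃ #Ш(E) ≤ ord₃ #Ш_an(E)` for
EVERY such curve, from published theorems + kernel glue** — Delbourgo 1998 Prop. 4 (`hDel`), GZK,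
modularity (`hmod`, `hmodD`), Wuthrich 2014 Lemma 20 (`hL20`: `ρ_{E♭,3^∞}` onto for the
multiplicative twist `E♭ = E^{(−3)}` from surj(3)) and Kato's divisibility read on the
`ω`-component over `ℚ(ζ_{3^∞})` (`hKato`, p233255: Kato 17.4 (3) / Wuthrich Thm. 3–Cor. 19
attribution), through `chiBranchLeadingTermOddBigImageAt_three` and the gen-7 consumer
`ClassX4M.missingUpperBoundAt_three_rankZero_of_chiBranch_of_surj`. NO `ram`, NO Tamagawa, NO
Manin, NO `j`-witness hypothesis. X4(M) stays CONSTRUCTION-SHAPED; nothing booked.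
[cite: Delbourgo1998, Prop. 4 (p. 144) and Lemma (ii) (p. 139)] [cite: Wuthrich2014, Lemma 20 (p. 399), Thm. 3 (p. 383), Cor. 19 (p. 398)]
[cite: Kato2004Asterisque, Thm. 17.4 (3) (p. 273)] -/
theorem ClassX4M.missingUpperBoundAt_three_rankZero_of_surj
    (hDel : Delbourgo1998.prop4_rankZero_pow_dvd_constantCoeff)
    (hGZK : rank_eq_analyticRank_of_analyticRank_le_one) (hmod : hasEntireLFunction_rat)
    (hmodD : nonempty_modularParametrizationData)
    (hL20 : Wuthrich2014.lemma20_surjective_threeAdic_of_semistable)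
    (hKato : Wuthrich2014.kato_minusEigenCharIdeal_dvd_cyclotomicThree_of_surjective)
    (hX : ClassX4M W 3) (hr : W.analyticRank = 0) (hsurj : Surj W 3) : MissingUpperBoundAt W 3 :=
  ClassX4M.missingUpperBoundAt_three_rankZero_of_chiBranch_of_surj hDel hGZK hmod hmodD hL20
    (chiBranchLeadingTermOddBigImageAt_three hKato W) hX hr hsurj

/-- **X4(M) ∧ `r_an(E) = 0` ∧ surj(3) ∧ `3 ∤ #Ш_an(E)`: `BSD(E,3)`** from published theorems + kernel
glue. [cite: Delbourgo1998, Prop. 4 (p. 144)] [cite: Wuthrich2014, Lemma 20 (p. 399), Cor. 19 (p. 398)]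
[cite: Kato2004Asterisque, Thm. 17.4 (3) (p. 273)] -/
theorem ClassX4M.bsdp_three_rankZero_of_surj_of_shaAn_unit
    (hDel : Delbourgo1998.prop4_rankZero_pow_dvd_constantCoeff)
    (hGZK : rank_eq_analyticRank_of_analyticRank_le_one) (hmod : hasEntireLFunction_rat)
    (hmodD : nonempty_modularParametrizationData)
    (hL20 : Wuthrich2014.lemma20_surjective_threeAdic_of_semistable)
    (hKato : Wuthrich2014.kato_minusEigenCharIdeal_dvd_cyclotomicThree_of_surjective)
    (hX : ClassX4M W 3) (hr : W.analyticRank = 0) (hsurj : Surj W 3)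
    {q : ℚ} (hq : shaAn W = (q : ℂ)) (hv : padicValRat 3 q = 0) : BSDp W 3 :=
  ClassX4M.bsdp_three_rankZero_of_chiBranch_of_surj_of_shaAn_unit hDel hGZK hmod hmodD hL20
    (chiBranchLeadingTermOddBigImageAt_three hKato W) hX hr hsurj hq hv

/-- **X4(M) ∧ `r_an(E) = 0` ∧ surj(3): `BSD(E,3)` from the LOWER half** (the `3 ∣ #Ш_an` rows: the 54
window pairs with `#Ш_an = 9`, where sha-2's certificate `Ш(E)[3] = (ℤ/3)²` IS that half).
[cite: Delbourgo1998, Prop. 4 (p. 144)] [cite: Wuthrich2014, Lemma 20 (p. 399), Cor. 19 (p. 398)]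
[cite: Kato2004Asterisque, Thm. 17.4 (3) (p. 273)] -/
theorem ClassX4M.bsdp_three_rankZero_of_surj_of_lower
    (hDel : Delbourgo1998.prop4_rankZero_pow_dvd_constantCoeff)
    (hGZK : rank_eq_analyticRank_of_analyticRank_le_one) (hmod : hasEntireLFunction_rat)
    (hmodD : nonempty_modularParametrizationData)
    (hL20 : Wuthrich2014.lemma20_surjective_threeAdic_of_semistable)
    (hKato : Wuthrich2014.kato_minusEigenCharIdeal_dvd_cyclotomicThree_of_surjective)
    (hX : ClassX4M W 3) (hr : W.analyticRank = 0) (hsurj : Surj W 3)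
    (hlow : MissingLowerBoundAt W 3) : BSDp W 3 :=
  ClassX4M.bsdp_three_rankZero_of_chiBranch_of_surj_of_lower hDel hGZK hmod hmodD hL20
    (chiBranchLeadingTermOddBigImageAt_three hKato W) hX hr hsurj hlow

/-- **X4(M) ∧ `r_an(E) = 0` ∧ surj(3) at `p = 3`: what remains of X4♯ is EXACTLY the lower half** —
`Typed.X4.MissingInputAt W 3 ⟺ MissingLowerBoundAt W 3`.
[cite: Delbourgo1998, Prop. 4 (p. 144)] [cite: Wuthrich2014, Lemma 20 (p. 399), Cor. 19 (p. 398)]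
[cite: Kato2004Asterisque, Thm. 17.4 (3) (p. 273)] -/
theorem ClassX4M.missingInputAt_iff_lower_three_rankZero_of_surj
    (hDel : Delbourgo1998.prop4_rankZero_pow_dvd_constantCoeff)
    (hGZK : rank_eq_analyticRank_of_analyticRank_le_one) (hmod : hasEntireLFunction_rat)
    (hmodD : nonempty_modularParametrizationData)
    (hL20 : Wuthrich2014.lemma20_surjective_threeAdic_of_semistable)
    (hKato : Wuthrich2014.kato_minusEigenCharIdeal_dvd_cyclotomicThree_of_surjective)
    (hX : ClassX4M W 3) (hr : W.analyticRank = 0) (hsurj : Surj W 3) :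
    X4.MissingInputAt W 3 ↔ MissingLowerBoundAt W 3 :=
  ClassX4M.missingInputAt_iff_lower_three_rankZero_of_chiBranch_of_surj hDel hGZK hmod hmodD hL20
    (chiBranchLeadingTermOddBigImageAt_three hKato W) hX hr hsurj

/-- **X4(M) ∧ `r_an(E) = 0` ∧ `3 ∤ ord₃ j(E)` at `p = 3`: the upper half** — surj(3) decided in the
kernel by `3 ∤ ord₃ j(E)` (`ClassX4M.surj_of_not_dvd_padicValRat_j`: the inertia at a potentially
multiplicative `3` supplies a transvection). E.g. the window pair 13221g1 (`ord₃ j = −19`,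
`3 ∣ ∏c_ℓ = 24`, `#Ш_an = 9`), structurally outside the Heegner-index route.
[cite: SilvermanATAEC1994, V.6 Prop. 6.1 (p. 410) and V.5.3] [cite: Wuthrich2014, Lemma 20 (p. 399), Cor. 19 (p. 398)]
[cite: Delbourgo1998, Prop. 4 (p. 144)] -/
theorem ClassX4M.missingUpperBoundAt_three_rankZero_of_not_dvd_padicValRat_j
    (hDel : Delbourgo1998.prop4_rankZero_pow_dvd_constantCoeff)
    (hGZK : rank_eq_analyticRank_of_analyticRank_le_one) (hmod : hasEntireLFunction_rat)
    (hmodD : nonempty_modularParametrizationData)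
    (hL20 : Wuthrich2014.lemma20_surjective_threeAdic_of_semistable)
    (hKato : Wuthrich2014.kato_minusEigenCharIdeal_dvd_cyclotomicThree_of_surjective)
    (hX : ClassX4M W 3) (hr : W.analyticRank = 0) (hj : ¬ (3 : ℤ) ∣ padicValRat 3 W.j) :
    MissingUpperBoundAt W 3 :=
  ClassX4M.missingUpperBoundAt_three_rankZero_of_surj hDel hGZK hmod hmodD hL20 hKato hX hr
    (ClassX4M.surj_of_not_dvd_padicValRat_j hX (by exact_mod_cast hj))

/-- **X4(M) ∧ `r_an(E) = 0` ∧ `3 ∤ ord₃ j(E)` ∧ `3 ∤ #Ш_an(E)`: `BSD(E,3)`.**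
[cite: Delbourgo1998, Prop. 4 (p. 144)] [cite: Wuthrich2014, Lemma 20 (p. 399), Cor. 19 (p. 398)] -/
theorem ClassX4M.bsdp_three_rankZero_of_not_dvd_padicValRat_j_of_shaAn_unit
    (hDel : Delbourgo1998.prop4_rankZero_pow_dvd_constantCoeff)
    (hGZK : rank_eq_analyticRank_of_analyticRank_le_one) (hmod : hasEntireLFunction_rat)
    (hmodD : nonempty_modularParametrizationData)
    (hL20 : Wuthrich2014.lemma20_surjective_threeAdic_of_semistable)
    (hKato : Wuthrich2014.kato_minusEigenCharIdeal_dvd_cyclotomicThree_of_surjective)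
    (hX : ClassX4M W 3) (hr : W.analyticRank = 0) (hj : ¬ (3 : ℤ) ∣ padicValRat 3 W.j)
    {q : ℚ} (hq : shaAn W = (q : ℂ)) (hv : padicValRat 3 q = 0) : BSDp W 3 :=
  bsdp_of_missingPPartAt W 3 hGZK (by rw [hr]; exact zero_le_one)
    (missingPPartAt_of_upper_of_shaAn_unit W 3
      (ClassX4M.missingUpperBoundAt_three_rankZero_of_not_dvd_padicValRat_j hDel hGZK hmod hmodD
        hL20 hKato hX hr hj) hq hv)

/-- **X4(M) ∧ `r_an(E) = 0` ∧ `3 ∤ ord₃ j(E)`: `BSD(E,3)` from the LOWER half** (e.g. 13221g1 at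
`p = 3` with sha-2's certificate `Ш(E)[3] = (ℤ/3)²`). [cite: Delbourgo1998, Prop. 4 (p. 144)]
[cite: Wuthrich2014, Lemma 20 (p. 399), Cor. 19 (p. 398)] -/
theorem ClassX4M.bsdp_three_rankZero_of_not_dvd_padicValRat_j_of_lower
    (hDel : Delbourgo1998.prop4_rankZero_pow_dvd_constantCoeff)
    (hGZK : rank_eq_analyticRank_of_analyticRank_le_one) (hmod : hasEntireLFunction_rat)
    (hmodD : nonempty_modularParametrizationData)
    (hL20 : Wuthrich2014.lemma20_surjective_threeAdic_of_semistable)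
    (hKato : Wuthrich2014.kato_minusEigenCharIdeal_dvd_cyclotomicThree_of_surjective)
    (hX : ClassX4M W 3) (hr : W.analyticRank = 0) (hj : ¬ (3 : ℤ) ∣ padicValRat 3 W.j)
    (hlow : MissingLowerBoundAt W 3) : BSDp W 3 :=
  bsdp_of_missingPPartAt W 3 hGZK (by rw [hr]; exact zero_le_one)
    (missingPPartAt_of_lower_of_upper W 3 hlow
      (ClassX4M.missingUpperBoundAt_three_rankZero_of_not_dvd_padicValRat_j hDel hGZK hmod hmodD
        hL20 hKato hX hr hj))

end Summit.BirchSwinnertonDyer.Rank1Residual.AdditivePotMult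

end
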